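import Summits.CriticalPhenomena.Ising3DConformalLimit.Theses.SynchronousCoupling
import Summits.CriticalPhenomena.Ising3DConformalLimit.Theses.InverseSquareTelemetry
import Summits.CriticalPhenomena.Ising3DConformalLimit.Theorems.HyperoctahedralRPExistsScaleCovariantLimitCompactnessItemMapsDoubling
import Literature.Probability.LatticeModels.LatticeLaplacianZd
import Literature.Probability.LatticeModels.CriticalTwoPointBounds
import Literature.Probability.LatticeModels.HighDimPointwiseTriviality
import HarnessLib

/-!
# Line `SketchIdeator2` — card B `bounded-telemetry-harnack` — for crux `UniformRegularity` (stmt-CriticalPhenomena-4658)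

Lead skeleton (prover-line-stmt-CriticalPhenomena-4658-0, 2026-08-17, after line `Sketch` died — `Lines/SketchDead.md`), built from
`Ideas/bounded-telemetry-harnack.md` and the ideator file `SketchIdeator2.lean` (`cardBReduction_holds`), route `SynchronousCoupling`.

## The line

`G := criticalTwoPoint 3 > 0` solves on `ℤ³ ∖ {0}` the lattice Schrödinger equation `ΔG = V_eff·G` with `V_eff := ΔG/G`
(`Δ = latticeLaplacianZd`, the 6-neighbour Laplacian). If the telemetry `T(x) := |x|₂² V_eff(x)` is BOUNDED (stub 2, open), the
scale-invariant elliptic Harnack inequality for `Δ − V` with `|V| ≤ C/|x|²` on the dyadic annuli (stub 1, provable from the LANDED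
small-potential Schrödinger–Harnack inequality on remote balls `schrodingerHarnack`, Theorems/InverseSquareTelemetryPositiveSolutionAsymptoticsFinal,
by chaining `O(1/ε)` balls of radius `εn` along the axis) compares `G(n e₀)` with `G(2n e₀)` uniformly in `n`: all-scale doubling
(item 6150), hence the crux (landed `uniformRegularity_iff_doubling`).

* `stub_axisHarnack` (PROVABLE NOW, M — analysis on `ℤ³`): for every `C > 0` there is `K` such that every GLOBALLY positive `u` with
  `Δu = Vu` and `|x|₂²|V| ≤ C` on the fat annulus `{n/4 ≤ |x|₂ ≤ 8n}` satisfies `u(n e₀) ≤ K·u(2n e₀)`, for all `n ≥ 1`.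
  (Reshaped from the card's `AnnulusHarnack`, which is false at `n = 1` without global positivity: `u` is free at the origin, a
  neighbour of the middle annulus. Large `n`: the landed lattice chain `stub_annulusChain` (r = 2n, steps θr, N(θ) points in
  {n/2 ≤ |·|₂ ≤ 4n}) and `schrodingerHarnack` on balls of radius 16θr ⊆ {n/4 ≤ |·|₂ ≤ 8n} with 16θr·(1+√(C/c₀)) ≤ n/4;
  small `n`: one-step comparisons `u(k e₀) ≤ (6 + 4C)·u((k+1) e₀)` from the equation and `u ≥ 0`.)
* `stub_boundedTelemetry` (OPEN — the transferred crux C⁺, held by the lead): `∃ C, ∀ x ≠ 0, |x|₂²·|ΔG(x)| ≤ C·G(x)`.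
  Strictly STRONGER than the crux (6150 ∧ transverse second-order control); implied by item 4495 `InverseSquareLaw`
  (`boundedTelemetry_of_inverseSquareLaw` below, proved), so this line also lands the edge 4495 ⟹ 4658.

## Composition (kernel-checked, no sorry outside the stubs)
`twoPointDoubling_of`: `u = G`, `V = ΔG/G`; `UniformRegularity_of` via the landed item map; `uniformRegularity_of_inverseSquareLaw`.

Disproof used: `Cruxes/UniformRegularity/Disproof.lean` v1 (NOT refuted; all crux hypotheses load-bearing; axis facts do not decide
doubling) — consistent: BoundedTelemetry is not an axis fact (the kinked doubling witness `gW` violates it).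
References: Delmotte 1997/1999; Barlow 2017 Thm 7.19; Gilbarg–Trudinger Thm 8.20; ADC21 §5.6 [AizenmanDuminilCopinAnnals2021];
Callen 1963 (item 4500).
-/

noncomputable section

namespace Summit.CriticalPhenomena.Ising3DConformalLimit.Cruxes.UniformRegularity.TelemetryHarnack

open scoped BigOperators
open Literature.Probability.LatticeModels

/-! ## The registered stubs -/

/-- **STUB 1 · `stub_axisHarnack` (PROVABLE NOW, M).** Scale-invariant Harnack comparison along the axis for globally positive
solutions of the lattice Schrödinger equation with an inverse-square-bounded potential on the fat dyadic annulus of `ℤ³`.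
[Delmotte1999 Thm 1.7; Barlow2017 Thm 7.19; GilbargTrudinger Thm 8.20] -/
theorem stub_axisHarnack :
    ∀ C : ℝ, 0 < C → ∃ K : ℝ, 0 < K ∧
      ∀ (u V : Literature.Probability.LatticeModels.Site 3 → ℝ) (n : ℕ), 1 ≤ n →
        (∀ x : Literature.Probability.LatticeModels.Site 3, 0 < u x) →
        (∀ x : Literature.Probability.LatticeModels.Site 3,
            (n : ℝ) / 4 ≤ Real.sqrt (∑ i, ((x i : ℝ)) ^ 2) → Real.sqrt (∑ i, ((x i : ℝ)) ^ 2) ≤ 8 * n →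
              Literature.Probability.LatticeModels.latticeLaplacianZd u x = V x * u x ∧
                (∑ i, ((x i : ℝ)) ^ 2) * |V x| ≤ C) →
        u (Pi.single 0 (n : ℤ)) ≤ K * u (Pi.single 0 (2 * (n : ℤ))) := by
  sorry

/-- **STUB 2 · `stub_boundedTelemetry` (OPEN — the transferred crux C⁺).** The exact effective potential `ΔG/G` of the critical
two-point function of `ℤ³` is in the scale-invariant Kato class: `sup_{x≠0} |x|₂²|ΔG(x)|/G(x) < ∞`.
[AizenmanDuminilCopinAnnals2021 §5.6, Rem 5.10; Callen1963] -/
theorem stub_boundedTelemetry :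
    ∃ C : ℝ, ∀ x : Literature.Probability.LatticeModels.Site 3, x ≠ 0 →
      (∑ i, ((x i : ℝ)) ^ 2) *
          |Literature.Probability.LatticeModels.latticeLaplacianZd
              (Literature.Probability.LatticeModels.criticalTwoPoint 3) x| ≤
        C * Literature.Probability.LatticeModels.criticalTwoPoint 3 x := by
  sorry

/-! ## Names for the statements -/

namespace Statement

/-- Statement of `stub_axisHarnack`. -/
abbrev stub_axisHarnack : Prop := type_of% TelemetryHarnack.stub_axisHarnack
/-- Statement of `stub_boundedTelemetry`. -/
abbrev stub_boundedTelemetry : Prop := type_of% TelemetryHarnack.stub_boundedTelemetry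

end Statement

/-! ## Landed inputs and small lemmas -/

/-- The crux decl of route `SynchronousCoupling` is verbatim the `MonotoneRG` one. [folklore] -/
theorem monotoneRG_iff_synchronousCoupling :
    Summit.CriticalPhenomena.Ising3DConformalLimit.Theses.MonotoneRG.UniformRegularity ↔
      Summit.CriticalPhenomena.Ising3DConformalLimit.Theses.SynchronousCoupling.UniformRegularity :=
  Iff.rfl

/-- `G = ⟨σ₀σ_x⟩_{β_c} > 0` on `ℤ³` (Simon–Lieb lower bound off the origin, `G(0) = 1`). [folklore] -/
theorem criticalTwoPoint_pos (x : Site 3) : 0 < criticalTwoPoint 3 x := by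
  by_cases hx : x = 0
  · rw [hx, criticalTwoPoint_zero']; exact one_pos
  · obtain ⟨c, C, hc, hb⟩ := criticalTwoPoint_bounds_holds (d := 3) le_rfl
    exact lt_of_lt_of_le (mul_pos hc (Real.rpow_pos_of_pos (norm_pos_iff.2 hx) _)) (hb x hx).1

/-- A site at positive Euclidean distance is not the origin. [folklore] -/
theorem ne_zero_of_sqrt_pos {x : Site 3} {r : ℝ} (hr : 0 < r) (hx : r ≤ Real.sqrt (∑ i, ((x i : ℝ)) ^ 2)) : x ≠ 0 := by
  rintro rfl
  have : Real.sqrt (∑ i, (((0 : Site 3) i : ℝ)) ^ 2) = 0 := by simp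
  linarith

/-! ## The composition -/

/-- **Item 6150 `TwoPointDoubling` from the two stubs** (`u = G`, `V = ΔG/G`). [folklore] -/
theorem twoPointDoubling_of (h₁ : Statement.stub_axisHarnack) (h₂ : Statement.stub_boundedTelemetry) :
    Summit.CriticalPhenomena.Ising3DConformalLimit.Theses.MirrorHoelderCompactness.TwoPointDoubling := by
  obtain ⟨C, hC⟩ := h₂
  obtain ⟨K, hK, hKall⟩ := h₁ (max C 1) (lt_max_of_lt_right one_pos)
  refine ⟨K⁻¹, inv_pos.2 hK, fun n hn => ?_⟩
  set G : Site 3 → ℝ := criticalTwoPoint 3 with hGdef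
  set V : Site 3 → ℝ := fun x => latticeLaplacianZd G x / G x with hVdef
  have hGpos : ∀ x, 0 < G x := criticalTwoPoint_pos
  have hyp : ∀ x : Site 3, (n : ℝ) / 4 ≤ Real.sqrt (∑ i, ((x i : ℝ)) ^ 2) →
      Real.sqrt (∑ i, ((x i : ℝ)) ^ 2) ≤ 8 * n →
        latticeLaplacianZd G x = V x * G x ∧ (∑ i, ((x i : ℝ)) ^ 2) * |V x| ≤ max C 1 := by
    intro x hlo _
    have hn1 : (1 : ℝ) ≤ n := by exact_mod_cast hn
    have hnpos : (0 : ℝ) < n / 4 := by linarith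
    have hx0 : x ≠ 0 := ne_zero_of_sqrt_pos hnpos hlo
    refine ⟨(div_mul_cancel₀ _ (hGpos x).ne').symm, ?_⟩
    have h1 : (∑ i, ((x i : ℝ)) ^ 2) * |V x| = (∑ i, ((x i : ℝ)) ^ 2) * |latticeLaplacianZd G x| / G x := by
      rw [hVdef, abs_div, abs_of_pos (hGpos x), mul_div_assoc]
    rw [h1, div_le_iff₀ (hGpos x)]
    calc (∑ i, ((x i : ℝ)) ^ 2) * |latticeLaplacianZd G x| ≤ C * G x := hC x hx0
      _ ≤ max C 1 * G x := mul_le_mul_of_nonneg_right (le_max_left _ _) (hGpos x).le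
  have key := hKall G V n hn hGpos hyp
  rw [inv_mul_le_iff₀ hK]
  exact key

/-- **`UniformRegularity` (route `SynchronousCoupling`) from the stubs**: doubling, then the landed item map 6150 ⟹ 4658. -/
theorem UniformRegularity_of (h₁ : Statement.stub_axisHarnack) (h₂ : Statement.stub_boundedTelemetry) :
    Summit.CriticalPhenomena.Ising3DConformalLimit.Theses.SynchronousCoupling.UniformRegularity :=
  monotoneRG_iff_synchronousCoupling.1
    (Summit.CriticalPhenomena.Ising3DConformalLimit.Cruxes.ExistsScaleCovariantLimit.TwoHierarchies.ItemMaps.uniformRegularity_of_doubling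
      (twoPointDoubling_of h₁ h₂))

/-! ## The cross-route edge: item 4495 `InverseSquareLaw` ⟹ stub 2 ⟹ the crux -/

/-- **Item 4495 ⟹ bounded telemetry** (proved): a cofinite inverse-square LAW with Dini rate is in particular a BOUND
(`|x|₂ ≥ 1` off the origin, so `|x|₂^{−ε} ≤ 1`). [folklore] -/
theorem boundedTelemetry_of_inverseSquareLaw
    (hISL : Summit.CriticalPhenomena.Ising3DConformalLimit.Theses.InverseSquareTelemetry.InverseSquareLaw) :
    Statement.stub_boundedTelemetry := by
  obtain ⟨κ, ε, C, hκ, hε, hall⟩ := hISL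
  refine ⟨κ + max C 0, fun x hx => ?_⟩
  have hGpos := criticalTwoPoint_pos x
  set r2 : ℝ := ∑ i, ((x i : ℝ)) ^ 2 with hr2
  -- the route's Laplacian is `latticeLaplacianZd` in `d = 3`
  have hlap : (∑ i : Fin 3, (criticalTwoPoint 3 (x + Pi.single i 1) + criticalTwoPoint 3 (x - Pi.single i 1))) -
      6 * criticalTwoPoint 3 x = latticeLaplacianZd (criticalTwoPoint 3) x := by
    rw [latticeLaplacianZd_def]; norm_num
  have h := hall x hx
  rw [hlap] at h
  -- `|x|₂ ≥ 1` for `x ≠ 0` in `ℤ³`, hence `|x|₂^{-ε} ≤ 1`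
  have hr2_one : 1 ≤ r2 := by
    obtain ⟨i, hi⟩ : ∃ i, x i ≠ 0 := by
      by_contra hcon
      push Not at hcon
      exact hx (funext hcon)
    have h1 : (1 : ℝ) ≤ ((x i : ℝ)) ^ 2 := by
      have : (1 : ℤ) ≤ |x i| := Int.one_le_abs hi
      have : (1 : ℝ) ≤ |(x i : ℝ)| := by exact_mod_cast this
      nlinarith [abs_nonneg ((x i : ℝ)), sq_abs ((x i : ℝ))]
    exact h1.trans (Finset.single_le_sum (fun j _ => sq_nonneg ((x j : ℝ))) (Finset.mem_univ i))
  have hsqrt_one : 1 ≤ Real.sqrt r2 := by rw [← Real.sqrt_one]; exact Real.sqrt_le_sqrt hr2_one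
  have hrpow : Real.sqrt r2 ^ (-ε) ≤ 1 :=
    Real.rpow_le_one_of_one_le_of_nonpos hsqrt_one (by linarith)
  have hT : |r2 * (latticeLaplacianZd (criticalTwoPoint 3) x / criticalTwoPoint 3 x)| ≤ κ + max C 0 := by
    have := abs_sub_abs_le_abs_sub (r2 * (latticeLaplacianZd (criticalTwoPoint 3) x / criticalTwoPoint 3 x)) κ
    have hC0 : C * Real.sqrt r2 ^ (-ε) ≤ max C 0 := by
      rcases le_or_gt 0 C with hc | hc
      · calc C * Real.sqrt r2 ^ (-ε) ≤ C * 1 := mul_le_mul_of_nonneg_left hrpow hc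
          _ ≤ max C 0 := by rw [mul_one]; exact le_max_left _ _
      · exact le_trans (mul_nonpos_of_nonpos_of_nonneg hc.le (Real.rpow_nonneg (Real.sqrt_nonneg _) _))
          (le_max_right _ _)
    rw [abs_of_nonneg hκ] at this
    linarith
  -- unfold the quotient
  have hr2nn : 0 ≤ r2 := Finset.sum_nonneg fun j _ => sq_nonneg ((x j : ℝ))
  rw [abs_mul, abs_of_nonneg hr2nn, abs_div, abs_of_pos hGpos, ← mul_div_assoc, div_le_iff₀ hGpos] at hT
  exact hT

/-- **Item 4495 ⟹ the crux** modulo the analytic stub: `InverseSquareLaw → stub_axisHarnack → UniformRegularity`. [folklore] -/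
theorem uniformRegularity_of_inverseSquareLaw (h₁ : Statement.stub_axisHarnack)
    (hISL : Summit.CriticalPhenomena.Ising3DConformalLimit.Theses.InverseSquareTelemetry.InverseSquareLaw) :
    Summit.CriticalPhenomena.Ising3DConformalLimit.Theses.SynchronousCoupling.UniformRegularity :=
  UniformRegularity_of h₁ (boundedTelemetry_of_inverseSquareLaw hISL)

end Summit.CriticalPhenomena.Ising3DConformalLimit.Cruxes.UniformRegularity.TelemetryHarnack

end
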